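import Literature.NumberTheory.ModularForms.SiegelUpperHalfSpaceLevelCovering             -- ★ `isCancelSMul_levelGD`, `properlyDiscontinuousSMul_levelGD`
import Literature.AlgebraicGeometry.ModuliOfAbelianVarieties.SiegelAdmissibleClassUnique   -- ★ `exists_siegelLevelGroup_smul_of_isAdmissibleAt`
import HarnessLib

/-!
# Local uniqueness of period lifts: two continuous `𝔥_g`-valued maps that are pointwise `Γ_δ(N)`-related (`N ≥ 3`) and agree at
# one point agree near it ([Lange2023AbelianVarietiesComplex] §3.1.3 Prop. 3.1.9 + Remark 3.1.10 (2); [GenestierNgo2020] Prop. 1.3.2)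

Layer `Literature/AlgebraicGeometry/ModuliOfAbelianVarieties`, namespace
`Literature.AlgebraicGeometry.ModuliOfAbelianVarieties.SiegelModuli`.  THEOREMS ONLY (no definition, no named fact, no instance, no
notation, no `sorry`).  Cell `hodgecm-mathlib` (D-0151), FLOOR 0, P6 «MOD» (crux hLiu418 = stmt-HodgeConjecture-24832, `--supports`),
half A line L7, socket `stub_UNIVFAM` (printed letter P-3 «UNIV-FAMILY» ★ `siegelUniversalFamilyUniformisation`): the core of the
organ O5 «MATCH» of `StubUNIVFAM.closer.skeleton.v1` (LA7-plan deal v1, 2026-09-02) — a chart whose period family is tautological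
along SOME holomorphic `𝔥_g`-valued `Z` with `Z t₀ = s t₀` is tautological along the GIVEN lift `s` near `t₀`, because `Z t` and
`s t` classify the same fibre, hence are `Γ_δ(N)`-related, hence EQUAL near `t₀`.  HC_CM is proved only modulo the printed
citations until rung 0 closes; this file is generic and changes no count.

THE MATHEMATICS.  For `N ≥ 3` the image `Γ = levelGD δ N` of `Γ_δ(N)` in `Sp_{2g}(ℝ)` acts on `𝔥_g` PROPERLY DISCONTINUOUSLY
([Lange2023AbelianVarietiesComplex] §3.1.3 Prop. 3.1.9; ★ `properlyDiscontinuousSMul_levelGD`) and FREELY (ibid. Remark 3.1.10 (2),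
[GenestierNgo2020] Prop. 1.3.2 «for `N ≥ 3`, the group `Γ(N)` … acts freely»; ★ `isCancelSMul_levelGD`), so every `Z₀ ∈ 𝔥_g` has a
neighbourhood `W` with `γ W ∩ W = ∅` for all `γ ≠ 1` (Mathlib `ProperlyDiscontinuousSMul.exists_nhds_image_smul_eq_self` + freeness)
— the evenly covered neighbourhoods of the covering `𝔥_g → Γ∖𝔥_g` (★ `isQuotientCoveringMap_levelGD`).  CONSEQUENCE (unique
continuation of lifts): if `Z, s : T → 𝔥_g` are continuous at `t₀`, `Z t₀ = s t₀`, and `s t = γ_t • Z t` with `γ_t ∈ Γ` for `t` near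
`t₀`, then `γ_t = 1` and `Z t = s t` near `t₀`.  Three currencies of the relation are served: (§1) an abstract free properly
discontinuous action; (§2) the Möbius form `⟨s t⟩ = gDHom δ hδ M • ⟨Z t⟩`, `M ∈ Γ_δ(N)` — the OUTPUT of ★ class uniqueness
`exists_siegelLevelGroup_smul_of_isAdmissibleAt`; hence (§3) the ADMISSIBILITY form «some triple over `Spec ℂ` is admissible at
both `(Z t, r)` and `(s t, r)`» and (§4) the UNIFORMISATION form `unif (Z t) = unif (s t)` for any map `unif` with the `unif_iff`
clause of ★ (U) `siegelModuli_complexUniformisation` (★ `SiegelModuli.rel_iff_exists_smul` converts the `(M, C)`-relation).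

## References
* [Lange2023AbelianVarietiesComplex] H. Lange, *Abelian Varieties over the Complex Numbers* (2023), §3.1.3 Prop. 3.1.9 and
  Remark 3.1.10 (2) (held copy `book:lange1992-complex-abelian-varieties` p0161–p0162); §3.1.2 Prop. 3.1.4 (p0159–p0160).
* [GenestierNgo2020] A. Genestier, B. C. Ngô, *Lectures on Shimura varieties*, Prop. 1.3.2.
* [Milne2005ShimuraVarieties] J. S. Milne, *Introduction to Shimura Varieties* (2005), §6 Thm. 6.11 p. 74.
-/

set_option autoImplicit false

noncomputable section

open Filter Topology Set
open scoped Pointwise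

namespace Literature.AlgebraicGeometry.ModuliOfAbelianVarieties

namespace SiegelModuli

open Literature.NumberTheory.Automorphic (siegelUpperHalfSpace)
open Literature.NumberTheory.ModularForms.SiegelUpperHalfSpace (isCancelSMul_levelGD properlyDiscontinuousSMul_levelGD
  discreteTopology_levelGD)
open Literature.AlgebraicGeometry.Motives (specOver)
open Literature.AlgebraicGeometry.AbelianSchemes (PolarizedAbelianSchemeWithLevel)

/-! ### §1 A free properly discontinuous action: nearby related points are equal -/

section Abstract

variable {Γ X : Type*} [Group Γ] [TopologicalSpace X] [MulAction Γ X] [ContinuousConstSMul Γ X]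
  [ProperlyDiscontinuousSMul Γ X] [T2Space X] [LocallyCompactSpace X]
  {T : Type*} [TopologicalSpace T] {Z s : T → X} {t₀ : T}

/-- **Near a point, only `γ = 1` relates the values of two continuous maps that agree there** (free, properly discontinuous action
on a locally compact Hausdorff space: a small neighbourhood `W` of `Z t₀` has `γ W ∩ W = ∅` for `γ ≠ 1`).
[cite: Lange2023AbelianVarietiesComplex, §3.1.3 Prop. 3.1.9 and Remark 3.1.10 (2)] -/
theorem eventually_forall_smul_eq_imp_eq_one [IsCancelSMul Γ X] (hZ : ContinuousAt Z t₀) (hs : ContinuousAt s t₀)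
    (h₀ : Z t₀ = s t₀) : ∀ᶠ t in 𝓝 t₀, ∀ γ : Γ, s t = γ • Z t → γ = 1 := by
  obtain ⟨W, hW, hdisj⟩ := ProperlyDiscontinuousSMul.exists_nhds_image_smul_eq_self Γ (Z t₀)
  have hW' : W ∈ 𝓝 (s t₀) := h₀ ▸ hW
  filter_upwards [hZ.eventually_mem hW, hs.eventually_mem hW'] with t hZt hst γ hγ
  have hfix : γ • Z t₀ = Z t₀ := hdisj γ ⟨s t, ⟨Z t, hZt, hγ.symm⟩, hst⟩
  exact IsCancelSMul.eq_one_of_smul hfix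

/-- **Unique continuation of lifts** (free, properly discontinuous action): two maps continuous at `t₀`, equal at `t₀` and pointwise
`Γ`-related near `t₀` are EQUAL near `t₀`. [cite: Lange2023AbelianVarietiesComplex, §3.1.3 Prop. 3.1.9 and Remark 3.1.10 (2)] -/
theorem eventually_eq_of_exists_smul_eq [IsCancelSMul Γ X] (hZ : ContinuousAt Z t₀) (hs : ContinuousAt s t₀)
    (h₀ : Z t₀ = s t₀) (hrel : ∀ᶠ t in 𝓝 t₀, ∃ γ : Γ, s t = γ • Z t) : ∀ᶠ t in 𝓝 t₀, Z t = s t := by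
  filter_upwards [eventually_forall_smul_eq_imp_eq_one (Γ := Γ) hZ hs h₀, hrel] with t h1 ⟨γ, hγ⟩
  rw [hγ, h1 γ hγ, one_smul]

end Abstract

/-! ### §2 The Möbius form for `Γ_δ(N)`, `N ≥ 3` -/

variable {g N : ℕ} {δ : Fin g → ℕ} {T : Type*} [TopologicalSpace T]

/-- From an eventual statement at `t₀` inside an open `V ∋ t₀` to an open neighbourhood `V″ ⊆ V` (plumbing). [folklore] -/
private theorem exists_open_subset_of_eventually {V : Set T} (hV : IsOpen V) {t₀ : T} (ht₀ : t₀ ∈ V) {p : T → Prop}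
    (h : ∀ᶠ t in 𝓝 t₀, p t) : ∃ V'' : Set T, IsOpen V'' ∧ t₀ ∈ V'' ∧ V'' ⊆ V ∧ ∀ t ∈ V'', p t := by
  obtain ⟨O, hOp, hO, hO₀⟩ := eventually_nhds_iff.1 h
  exact ⟨O ∩ V, hO.inter hV, ⟨hO₀, ht₀⟩, inter_subset_right, fun t ht => hOp t ht.1⟩

/-- **UNIQUE CONTINUATION OF PERIOD LIFTS, MÖBIUS FORM** (`N ≥ 3`, `δᵢ ≥ 1`): on an open `V ∋ t₀` let `Z, s : T → M_g(ℂ)` be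
continuous and `𝔥_g`-valued with `Z t₀ = s t₀`, and suppose that for every `t ∈ V` the points are `Γ_δ(N)`-related in the Möbius
action, `⟨s t⟩ = gDHom δ hδ M • ⟨Z t⟩` for some `M ∈ Γ_δ(N)` (the output shape of ★ `exists_siegelLevelGroup_smul_of_isAdmissibleAt`).
Then `Z = s` on an open `V″ ∋ t₀`, `V″ ⊆ V` — `Γ_δ(N)` acts freely and properly discontinuously on `𝔥_g`.
[cite: Lange2023AbelianVarietiesComplex, §3.1.3 Prop. 3.1.9 and Remark 3.1.10 (2)] [cite: GenestierNgo2020, Prop. 1.3.2] -/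
theorem exists_open_eqOn_of_exists_gDHom_smul (hδ : ∀ i, 0 < δ i) (hN : 3 ≤ N) {V : Set T} (hV : IsOpen V) {t₀ : T}
    (ht₀ : t₀ ∈ V) {Z s : T → Matrix (Fin g) (Fin g) ℂ} (hZc : ContinuousOn Z V) (hsc : ContinuousOn s V)
    (hZ : ∀ t ∈ V, Z t ∈ siegelUpperHalfSpace g) (hs : ∀ t ∈ V, s t ∈ siegelUpperHalfSpace g) (h₀ : Z t₀ = s t₀)
    (hrel : ∀ t (ht : t ∈ V), ∃ M : symplecticLatticeGroup δ, (M : GL (Fin g ⊕ Fin g) ℤ) ∈ siegelLevelGroup δ N ∧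
      (⟨s t, hs t ht⟩ : siegelUpperHalfSpace g) = gDHom δ hδ M • (⟨Z t, hZ t ht⟩ : siegelUpperHalfSpace g)) :
    ∃ V'' : Set T, IsOpen V'' ∧ t₀ ∈ V'' ∧ V'' ⊆ V ∧ ∀ t ∈ V'', Z t = s t := by
  haveI := properlyDiscontinuousSMul_levelGD (g := g) hδ N
  haveI := isCancelSMul_levelGD (g := g) hδ hN
  -- restrict to the subtype `V`, where `Z`, `s` are honest `𝔥_g`-valued continuous maps
  let Z' : V → siegelUpperHalfSpace g := fun t => ⟨Z t, hZ t t.2⟩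
  let s' : V → siegelUpperHalfSpace g := fun t => ⟨s t, hs t t.2⟩
  have hZ'c : Continuous Z' := (hZc.restrict).subtype_mk _
  have hs'c : Continuous s' := (hsc.restrict).subtype_mk _
  have h₀' : Z' ⟨t₀, ht₀⟩ = s' ⟨t₀, ht₀⟩ := Subtype.ext h₀
  have hrel' : ∀ᶠ τ in 𝓝 (⟨t₀, ht₀⟩ : V), ∃ γ : levelGD δ N hδ, s' τ = γ • Z' τ := by
    refine Filter.Eventually.of_forall fun τ => ?_
    obtain ⟨M, hM, hMeq⟩ := hrel τ τ.2
    exact ⟨⟨gDHom δ hδ M, Subgroup.mem_map.2 ⟨M, Subgroup.mem_subgroupOf.2 hM, rfl⟩⟩, hMeq⟩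
  have hev : ∀ᶠ τ in 𝓝 (⟨t₀, ht₀⟩ : V), Z' τ = s' τ :=
    eventually_eq_of_exists_smul_eq hZ'c.continuousAt hs'c.continuousAt h₀' hrel'
  -- back to `T`: `V` is open, so neighbourhoods of `⟨t₀⟩` in `V` are traces of neighbourhoods of `t₀`
  have hev' : ∀ᶠ t in 𝓝 t₀, t ∈ V → Z t = s t := by
    rw [nhds_subtype_eq_comap, eventually_comap] at hev
    filter_upwards [hev] with t ht htV
    exact congrArg Subtype.val (ht ⟨t, htV⟩ rfl)
  obtain ⟨V'', hV''o, ht₀'', hsub, hp⟩ := exists_open_subset_of_eventually hV ht₀ hev'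
  exact ⟨V'', hV''o, ht₀'', hsub, fun t ht => hp t ht (hsub ht)⟩

/-! ### §3 The admissibility form -/

/-- **UNIQUE CONTINUATION OF PERIOD LIFTS, ADMISSIBILITY FORM** (`0 < g`, `δ` a polarisation type, `N ≥ 3`, `r ∈ K_δ(1)`): if along an
open `V ∋ t₀` two continuous `𝔥_g`-valued maps `Z, s` with `Z t₀ = s t₀` are such that, for every `t ∈ V`, SOME polarised abelian
variety with level structure over `Spec ℂ` is admissible (★ `IsAdmissibleAt`) at both `(Z t, r)` and `(s t, r)`, then `Z = s` on an
open `V″ ∋ t₀`, `V″ ⊆ V` (two admissible period points of one triple are `Γ_δ(N)`-related — ★ class uniqueness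
`exists_siegelLevelGroup_smul_of_isAdmissibleAt`, [Milne2005ShimuraVarieties] Thm. 6.11 — then §2).  The O5 «MATCH» step of L7: the
period point `Z t` of a normalised chart and the lift `s t` both mark the fibre `P_T|_t`.
[cite: Milne2005ShimuraVarieties, §6 Thm. 6.11 p. 74] [cite: Lange2023AbelianVarietiesComplex, §3.1.3 Prop. 3.1.9 and Remark 3.1.10 (2)] -/
theorem exists_open_eqOn_of_isAdmissibleAt (hg : 0 < g) (hδ : IsPolarizationType δ) (hN : 3 ≤ N)
    {r : gspFinAdelic δ} (hr : r ∈ principalLevelSubgroup δ 1) {V : Set T} (hV : IsOpen V) {t₀ : T} (ht₀ : t₀ ∈ V)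
    {Z s : T → Matrix (Fin g) (Fin g) ℂ} (hZc : ContinuousOn Z V) (hsc : ContinuousOn s V)
    (hZ : ∀ t ∈ V, Z t ∈ siegelUpperHalfSpace g) (hs : ∀ t ∈ V, s t ∈ siegelUpperHalfSpace g) (h₀ : Z t₀ = s t₀)
    (hadm : ∀ t (ht : t ∈ V), ∃ P' : PolarizedAbelianSchemeWithLevel g N δ (specOver ℚ ℂ).left,
      IsAdmissibleAt hδ r (Z t) (hZ t ht) P' ∧ IsAdmissibleAt hδ r (s t) (hs t ht) P') :
    ∃ V'' : Set T, IsOpen V'' ∧ t₀ ∈ V'' ∧ V'' ⊆ V ∧ ∀ t ∈ V'', Z t = s t := by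
  refine exists_open_eqOn_of_exists_gDHom_smul hδ.1 hN hV ht₀ hZc hsc hZ hs h₀ fun t ht => ?_
  obtain ⟨P', hPZ, hPs⟩ := hadm t ht
  exact exists_siegelLevelGroup_smul_of_isAdmissibleAt hg hδ hN hr (hs t ht) (hZ t ht) P' hPs hPZ

/-! ### §4 The uniformisation form -/

/-- **UNIQUE CONTINUATION OF PERIOD LIFTS, UNIFORMISATION FORM** (`N ≥ 3`, `δᵢ ≥ 1`): for any map `unif : M_g(ℂ) → Y` whose fibres on
`𝔥_g` are the `Γ_δ(N)`-classes in the sense of the `unif_iff` clause of ★ (U) `siegelModuli_complexUniformisation` (two period points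
have the same image iff `C ∘ Π_Z = Π_{Z′} ∘ M` for some `M ∈ Γ_δ(N)` and a `ℂ`-linear `C`), two continuous `𝔥_g`-valued LIFTS
`Z, s` of the same map (`unif (Z t) = unif (s t)` on an open `V ∋ t₀`) with `Z t₀ = s t₀` agree on an open `V″ ∋ t₀`, `V″ ⊆ V` — the
unique lifting property of the covering `𝔥_g → Γ_δ(N)∖𝔥_g ≅ S_c(ℂ)`.
[cite: GenestierNgo2020, Prop. 1.3.2] [cite: Lange2023AbelianVarietiesComplex, §3.1.2 Prop. 3.1.4, §3.1.3 Prop. 3.1.9 and Remark 3.1.10 (2)] -/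
theorem exists_open_eqOn_of_unif_eq (hδ : ∀ i, 0 < δ i) (hN : 3 ≤ N) {Y : Type*} (unif : Matrix (Fin g) (Fin g) ℂ → Y)
    (hiff : ∀ Z ∈ siegelUpperHalfSpace g, ∀ Z' ∈ siegelUpperHalfSpace g,
      unif Z = unif Z' ↔ ∃ M ∈ siegelLevelGroup δ N, ∃ C : (Fin g → ℂ) ≃ₗ[ℂ] (Fin g → ℂ),
        ∀ v : Fin g ⊕ Fin g → ℝ, C (siegelPeriodMap δ Z v) = siegelPeriodMap δ Z' (intAct M v))
    {V : Set T} (hV : IsOpen V) {t₀ : T} (ht₀ : t₀ ∈ V)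
    {Z s : T → Matrix (Fin g) (Fin g) ℂ} (hZc : ContinuousOn Z V) (hsc : ContinuousOn s V)
    (hZ : ∀ t ∈ V, Z t ∈ siegelUpperHalfSpace g) (hs : ∀ t ∈ V, s t ∈ siegelUpperHalfSpace g) (h₀ : Z t₀ = s t₀)
    (heq : ∀ t ∈ V, unif (Z t) = unif (s t)) :
    ∃ V'' : Set T, IsOpen V'' ∧ t₀ ∈ V'' ∧ V'' ⊆ V ∧ ∀ t ∈ V'', Z t = s t := by
  refine exists_open_eqOn_of_exists_gDHom_smul hδ hN hV ht₀ hZc hsc hZ hs h₀ fun t ht => ?_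
  have hrel := (hiff (Z t) (hZ t ht) (s t) (hs t ht)).1 (heq t ht)
  exact (rel_iff_exists_smul hδ (siegelLevelGroup_le_symplecticLatticeGroup δ N) (hZ t ht) (hs t ht)).1 hrel

end SiegelModuli

end Literature.AlgebraicGeometry.ModuliOfAbelianVarieties

end
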